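import Summits.QuantumFields.YangMills.Theorems.UnitScaleTiltProp7CornerCombChainPerCornerDressed
import Summits.QuantumFields.YangMills.Theorems.UnitScaleTiltProp7CornerCombDressedStepMean
import HarnessLib

/-!
# (n3)-COMB (II) «COMB = STRAIGHT ∘ BLOCK-AXIAL», file F-6c-3d: THE PER-CORNER ROW WITH THE ONE-SCALE ROWS DISCHARGED — ✓F-6c-3c `normSq_covGrad_gauge_le` ∘ ★routeR-w1 g9's
# F-6c-2b `normSq_invL_meanT_step_sub_meanT_le`: every displayed hypothesis is now tower data (backgrounds, plaquette sizes, two-level transports, the top loop window), every right side is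
# a covariant gradient energy, a mass, or the deviation of `G (j+1)` from the straight covariant step of `G j` (= ✓F-5's DEF), on EXPLICIT boxes at the corner chain — the letters F-6d sums.

Crux `stmt-QuantumFields-19200` `MinimiserStabilityRegPr`, route-R E′ (A′)-on-Σ, package P-A2, row (β); the DISPLAYED route-internal row `hMcomb` («(n3)-comb», SIGNATURE-0,
★★OWNER RULINGS №19 O4 ∕ №22; OPEN, XL) and its supplier design (II) (MASTER `DESIGN-N3COMB-LINEAR-CORE` 6efb31c3 §1 rows 6–8, §5; ★routeR-w1 g9 PENS ROUND 3 (iv) ∕ ROUND 4 «INPUT per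
level-k corner = F-6c-3's per-corner row with `Da j μ := L^{−2j}·[F-6c-2b RHS]`, top pair, oscillations»).  Seat `ym-ust-19200-w3` g13 (pen F-6c-3 of record); `--kind proof --supports
stmt-QuantumFields-19200 --as helper`; THEOREMS ONLY (0 `def`, 0 `sorry`); «(O2) groundwork — not consumed by any displayed row before the freeze lifts»; count-neutral.  YM₃ on T³ is a ladder
rung (R3), NOT d = 4, NOT infinite volume, NOT the Clay problem; nothing here is progress on the YM mass gap; nothing of `hMcomb` ∕ `hMcomb₂` ∕ (β) ∕ `hD` ∕ the stub ∕ the crux is proved or claimed.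

## What is here
★★★ `normSq_covGrad_gauge_le_of_stepMean` — ✓F-6c-3c with `hstep`∕`hstep'` DISCHARGED: at the step `j → j+1` (`j < k′`) F-6c-2b is read with `V := V j`, `V′ := V (j+1)`
(`hbs j : ‖V (j+1)(y,ν) − V j([L•y, L•y + L•e_ν])‖ ≤ δ j` — at the member `δ j = 4α_j`, ✓F-6c-2a §3), `X := G j`, `X′ := G (j+1)`, `q″ := L^{k′−j}•z` (resp. `L^{k′−j}•(z+e_κ)`), cube side
`n + 1 ≥ L² + L`, and the defect `D := G (j+1) − [straight covariant step of G j]` (so F-6c-2b's `hX′` holds by `sub_add_cancel`; the displayed defect slot is then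
`Σ_{s′}‖G (j+1)(q″+s′, μ) − Σ_rΣ_{t<L} L⁻ᵈ•Ad_{V_j(Γ_{L•(q″+s′), ·} ++ [·, +te_μ])} G j(L•(q″+s′)+r+te_μ, μ)‖²` = the block `ℓ²` mass of ✓F-5's `DEF_j(G_j)` after ★routeR-w4 cov-2 `smul_Q0cov_eq_sum`).
HONEST: a knit by name; no estimate beyond the cited tree theorems.
References: T. Bałaban, CMP 98 (1985) 17–51 [Balaban1985Averaging] ((42)–(47) pp.23–25, (112) p.34, (125)–(126) p.36); CMP 95 (1984) 17–40 [Balaban1984PropagatorsI] ((1.18)–(1.20) pp.19–20);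
CMP 96 (1984) 223–250 [Balaban1984PropagatorsII] ((2.19)–(2.22) p.226: the gauge-fixed operator `Δ_a` and its Green's function, whose block-scale transience the chain replaces); [Balaban1983RegularityDecay] ((2.27) p.580).
-/

set_option autoImplicit false

noncomputable section

open scoped BigOperators Matrix.Norms.L2Operator
open Finset

namespace Summit.QuantumFields.YangMills.Theorems.Prop7CornerCombChainPerCornerOfStepMean

open Literature.MathematicalPhysics.QuantumFieldTheory.Balaban1983to89
open B7Prop1Explicit (Site Letter e hol seg treeWord boxVec disp plaqWord l1 U1 mem_U1 hol_mem Wcx bavg)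
open B7Eq78Linearization (conjR conjR_apply conjR_add conjR_sub conjR_smul_real)
open B7Prop3GeneralLinear (FhatCov)
open Summit.QuantumFields.YangMills.Theorems.Prop7CornerCombChainPerCornerDressed (normSq_covGrad_gauge_le)
open Summit.QuantumFields.YangMills.Theorems.Prop7CornerCombDressedStepMean (normSq_invL_meanT_step_sub_meanT_le)

variable {d N : ℕ} [NeZero N]

/-- ★★★ **THE PER-CORNER ROW OF THE ACCUMULATED COMB GAUGE FUNCTION, ONE-SCALE ROWS DISCHARGED** (✓F-6c-3c ∘ F-6c-2b).  Tower `V i` of `U1` backgrounds with plaquettes within `a i`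
(`i ≤ k′`) and two-level transports `‖V (j+1)(y,ν) − V j([L•y, L•y+L•e_ν])‖ ≤ δ j` (`j < k′`); level fields `G i`; the accumulated gauge function `Λ` of the cornered comb means; cube side
`n+1 ≥ L²+L`; the top loop window `w ≤ 1∕8` at `(L•z, κ)` and `V̄^{(k′)}(L•z,κ) ∈ U1`.  Conclusion: ✓F-6c-3c's bound with `E j μ` (resp. `E′ j μ`) REPLACED by F-6c-2b's right side at
`(V j, V (j+1), G j, G (j+1), q″ = L^{k′−j}•z)` (resp. `z + e_κ`), the defect read as `G (j+1) −` the straight covariant step of `G j`.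
[cite: Balaban1985Averaging, (42)-(47) pp.23-25, (112) p.34, (125)-(126) p.36; Balaban1984PropagatorsI, (1.18)-(1.20) pp.19-20; Balaban1984PropagatorsII, (2.19)-(2.22) p.226; Balaban1983RegularityDecay, (2.27) p.580] -/
theorem normSq_covGrad_gauge_le_of_stepMean (L : ℕ) (hL : 2 ≤ L) (n : ℕ) (hn : L * L + L ≤ n + 1) (k' : ℕ)
    (V : ℕ → Site d → Fin d → (Matrix (Fin N) (Fin N) ℂ)ˣ) (hV : ∀ i x μ, V i x μ ∈ U1 (Matrix (Fin N) (Fin N) ℂ))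
    (a : ℕ → ℝ) (ha : ∀ i, 0 ≤ a i)
    (hplaq : ∀ i, i ≤ k' → ∀ (x : Site d) (μ ν : Fin d), μ ≠ ν → ‖((hol (V i) x (plaqWord μ ν) : (Matrix (Fin N) (Fin N) ℂ)ˣ) : Matrix (Fin N) (Fin N) ℂ) - 1‖ ≤ a i)
    (δ : ℕ → ℝ) (hδ : ∀ j, 0 ≤ δ j)
    (hbs : ∀ j, j < k' → ∀ (y : Site d) (ν : Fin d), ‖((V (j + 1) y ν : (Matrix (Fin N) (Fin N) ℂ)ˣ) : Matrix (Fin N) (Fin N) ℂ)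
      - ((hol (V j) ((L : ℤ) • y) (seg ν (L : ℤ)) : (Matrix (Fin N) (Fin N) ℂ)ˣ) : Matrix (Fin N) (Fin N) ℂ)‖ ≤ δ j)
    (z : Site d) (κ : Fin d) {w : ℝ}
    (hw : ∀ r : Fin d → Fin L, ‖((Wcx L (V k') ((L : ℤ) • z) κ (boxVec L r) : (Matrix (Fin N) (Fin N) ℂ)ˣ) : Matrix (Fin N) (Fin N) ℂ) - 1‖ ≤ w) (hw8 : w ≤ 1 / 8)
    (hbU : bavg L (V k') ((L : ℤ) • z) κ ∈ U1 (Matrix (Fin N) (Fin N) ℂ))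
    (G : ℕ → Site d → Fin d → Matrix (Fin N) (Fin N) ℂ) (Λ : ℕ → Site d → Matrix (Fin N) (Fin N) ℂ) (hΛ0 : ∀ y, Λ 0 y = 0)
    (hΛs : ∀ (i : ℕ) (y : Site d), Λ (i + 1) y = FhatCov L (V i) (G i) ((L : ℤ) • y) + Λ i ((L : ℤ) • y)) :
    ‖Λ (k' + 1) z - conjR (bavg L (V k') ((L : ℤ) • z) κ) (Λ (k' + 1) (z + e κ))‖ ^ 2
      ≤ 3 * ((d : ℝ) * (((L : ℝ) ^ (k' + 1) - 1) / 2) ^ 2 * ∑ μ : Fin d, (((L : ℝ) ^ k')⁻¹ ^ 2 *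
              (2 * ((L : ℝ) ^ d)⁻¹ * (L : ℝ) * ∑ s : Fin d → Fin L, ∑ t ∈ range L,
                  ‖conjR (V k' ((L : ℤ) • z + boxVec L s + (t : ℤ) • e κ) κ) (G k' ((L : ℤ) • z + boxVec L s + (t : ℤ) • e κ + e κ) μ) - G k' ((L : ℤ) • z + boxVec L s + (t : ℤ) • e κ) μ‖ ^ 2
                + 2 * ((L : ℝ) ^ d)⁻¹ * (8 * (((d : ℝ) + 1) * (L : ℝ)) ^ 2 * a k' + 8 * w) ^ 2 * ∑ s : Fin d → Fin L, ‖G k' ((L : ℤ) • z + (L : ℤ) • e κ + boxVec L s) μ‖ ^ 2))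
          + 2 * (d : ℝ) * (1 - (Real.sqrt L)⁻¹)⁻¹
              * ∑ j ∈ range k', (Real.sqrt L) ^ (k' - 1 - j) * (((L : ℝ) ^ (j + 1) - 1) / 2) ^ 2 * ∑ μ : Fin d,
                (((L : ℝ) ^ j)⁻¹ ^ 2 *
                  (((L : ℝ) ^ d)⁻¹ *
                      (3 * N * ((n : ℝ) + 1) ^ 2 *
                          ∑ μ' : Fin d, ∑ ν : Fin d, ∑ ρ ∈ univ.filter (fun ρ : Fin d → Fin (n + 1) => ρ ν ≠ Fin.last n),
                            ‖conjR (V j (((L : ℤ) ^ (k' + 1 - j)) • z + boxVec (n + 1) ρ) ν) (G j (((L : ℤ) ^ (k' + 1 - j)) • z + boxVec (n + 1) ρ + e ν) μ')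
                              - G j (((L : ℤ) ^ (k' + 1 - j)) • z + boxVec (n + 1) ρ) μ'‖ ^ 2
                        + (12 * N * ((n : ℝ) + 1) ^ 2 * (d : ℝ) ^ 3 * (n : ℝ) ^ 2 * a j ^ 2
                            + 3 * (2 * d * L * δ j + 2 * ((3 * d + 1) * n : ℝ) ^ 2 * a j) ^ 2) *
                          ∑ μ' : Fin d, ∑ ρ : Fin d → Fin (n + 1), ‖G j (((L : ℤ) ^ (k' + 1 - j)) • z + boxVec (n + 1) ρ) μ'‖ ^ 2)
                    + 3 * ((L : ℝ) ^ 2)⁻¹ * ((L : ℝ) ^ d)⁻¹ * ∑ s' : Fin d → Fin L,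
                        ‖G (j + 1) (((L : ℤ) ^ (k' - j)) • z + boxVec L s') μ
                          - ∑ r : Fin d → Fin L, ∑ t ∈ Finset.range L, (((L : ℝ) ^ d)⁻¹) •
                              conjR (hol (V j) ((L : ℤ) • (((L : ℤ) ^ (k' - j)) • z + boxVec L s')) (treeWord (boxVec L r) ++ seg μ (t : ℤ)))
                                (G j ((L : ℤ) • (((L : ℤ) ^ (k' - j)) • z + boxVec L s') + boxVec L r + (t : ℤ) • e μ) μ)‖ ^ 2)
                + ((L : ℝ) ^ j)⁻¹ ^ 2 *
                  (((L : ℝ) ^ d)⁻¹ *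
                      (3 * N * ((n : ℝ) + 1) ^ 2 *
                          ∑ μ' : Fin d, ∑ ν : Fin d, ∑ ρ ∈ univ.filter (fun ρ : Fin d → Fin (n + 1) => ρ ν ≠ Fin.last n),
                            ‖conjR (V j (((L : ℤ) ^ (k' + 1 - j)) • (z + e κ) + boxVec (n + 1) ρ) ν) (G j (((L : ℤ) ^ (k' + 1 - j)) • (z + e κ) + boxVec (n + 1) ρ + e ν) μ')
                              - G j (((L : ℤ) ^ (k' + 1 - j)) • (z + e κ) + boxVec (n + 1) ρ) μ'‖ ^ 2
                        + (12 * N * ((n : ℝ) + 1) ^ 2 * (d : ℝ) ^ 3 * (n : ℝ) ^ 2 * a j ^ 2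
                            + 3 * (2 * d * L * δ j + 2 * ((3 * d + 1) * n : ℝ) ^ 2 * a j) ^ 2) *
                          ∑ μ' : Fin d, ∑ ρ : Fin d → Fin (n + 1), ‖G j (((L : ℤ) ^ (k' + 1 - j)) • (z + e κ) + boxVec (n + 1) ρ) μ'‖ ^ 2)
                    + 3 * ((L : ℝ) ^ 2)⁻¹ * ((L : ℝ) ^ d)⁻¹ * ∑ s' : Fin d → Fin L,
                        ‖G (j + 1) (((L : ℤ) ^ (k' - j)) • (z + e κ) + boxVec L s') μ
                          - ∑ r : Fin d → Fin L, ∑ t ∈ Finset.range L, (((L : ℝ) ^ d)⁻¹) •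
                              conjR (hol (V j) ((L : ℤ) • (((L : ℤ) ^ (k' - j)) • (z + e κ) + boxVec L s')) (treeWord (boxVec L r) ++ seg μ (t : ℤ)))
                                (G j ((L : ℤ) • (((L : ℤ) ^ (k' - j)) • (z + e κ) + boxVec L s') + boxVec L r + (t : ℤ) • e μ) μ)‖ ^ 2))
          + 2 * (1 - (Real.sqrt L)⁻¹)⁻¹ * ∑ i ∈ range (k' + 1), (Real.sqrt L) ^ (k' - i) *
              ((N / 2 * (d : ℝ) ^ 2 * ((L : ℝ) - 1) ^ 2 * (L : ℝ) ^ 2 *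
                  ∑ μ : Fin d, ∑ ν : Fin d, ∑ s ∈ univ.filter (fun s : Fin d → Fin L => (s ν : ℕ) + 1 ≠ L),
                    ‖conjR (V i (((L : ℤ) ^ (k' + 1 - i)) • z + boxVec L s) ν) (G i (((L : ℤ) ^ (k' + 1 - i)) • z + boxVec L s + e ν) μ) - G i (((L : ℤ) ^ (k' + 1 - i)) • z + boxVec L s) μ‖ ^ 2
                + (8 * (d : ℝ) ^ 6 * ((L : ℝ) - 1) ^ 6 + 2 * N * (d : ℝ) ^ 5 * ((L : ℝ) - 1) ^ 4 * (L : ℝ) ^ 2) * a i ^ 2 *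
                  ∑ s : Fin d → Fin L, ∑ μ : Fin d, ‖G i (((L : ℤ) ^ (k' + 1 - i)) • z + boxVec L s) μ‖ ^ 2)
              + (N / 2 * (d : ℝ) ^ 2 * ((L : ℝ) - 1) ^ 2 * (L : ℝ) ^ 2 *
                  ∑ μ : Fin d, ∑ ν : Fin d, ∑ s ∈ univ.filter (fun s : Fin d → Fin L => (s ν : ℕ) + 1 ≠ L),
                    ‖conjR (V i (((L : ℤ) ^ (k' + 1 - i)) • (z + e κ) + boxVec L s) ν) (G i (((L : ℤ) ^ (k' + 1 - i)) • (z + e κ) + boxVec L s + e ν) μ) - G i (((L : ℤ) ^ (k' + 1 - i)) • (z + e κ) + boxVec L s) μ‖ ^ 2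
                + (8 * (d : ℝ) ^ 6 * ((L : ℝ) - 1) ^ 6 + 2 * N * (d : ℝ) ^ 5 * ((L : ℝ) - 1) ^ 4 * (L : ℝ) ^ 2) * a i ^ 2 *
                  ∑ s : Fin d → Fin L, ∑ μ : Fin d, ‖G i (((L : ℤ) ^ (k' + 1 - i)) • (z + e κ) + boxVec L s) μ‖ ^ 2))) := by
  have hL1 : 1 ≤ L := by omega
  -- the one-scale rows at the two corner chains, from F-6c-2b with the tautological defect
  have hcorner : ∀ j, j < k' → ∀ y : Site d, (L : ℤ) • (((L : ℤ) ^ (k' - j)) • y) = ((L : ℤ) ^ (k' + 1 - j)) • y := by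
    intro j hj y
    rw [smul_smul, ← pow_succ', show k' - j + 1 = k' + 1 - j by omega]
  have hrow : ∀ (y : Site d) (j : ℕ), j < k' → ∀ μ : Fin d,
      ‖((L : ℝ)⁻¹ • ((((L : ℝ) ^ d)⁻¹) • ∑ s : Fin d → Fin L,
            conjR (hol (V (j + 1)) (((L : ℤ) ^ (k' - j)) • y) (treeWord (boxVec L s))) (G (j + 1) (((L : ℤ) ^ (k' - j)) • y + boxVec L s) μ)))
        - ((((L : ℝ) ^ d)⁻¹) • ∑ s : Fin d → Fin L,
            conjR (hol (V j) (((L : ℤ) ^ (k' + 1 - j)) • y) (treeWord (boxVec L s))) (G j (((L : ℤ) ^ (k' + 1 - j)) • y + boxVec L s) μ))‖ ^ 2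
      ≤ ((L : ℝ) ^ d)⁻¹ *
          (3 * N * ((n : ℝ) + 1) ^ 2 *
              ∑ μ' : Fin d, ∑ ν : Fin d, ∑ ρ ∈ univ.filter (fun ρ : Fin d → Fin (n + 1) => ρ ν ≠ Fin.last n),
                ‖conjR (V j (((L : ℤ) ^ (k' + 1 - j)) • y + boxVec (n + 1) ρ) ν) (G j (((L : ℤ) ^ (k' + 1 - j)) • y + boxVec (n + 1) ρ + e ν) μ')
                  - G j (((L : ℤ) ^ (k' + 1 - j)) • y + boxVec (n + 1) ρ) μ'‖ ^ 2
            + (12 * N * ((n : ℝ) + 1) ^ 2 * (d : ℝ) ^ 3 * (n : ℝ) ^ 2 * a j ^ 2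
                + 3 * (2 * d * L * δ j + 2 * ((3 * d + 1) * n : ℝ) ^ 2 * a j) ^ 2) *
              ∑ μ' : Fin d, ∑ ρ : Fin d → Fin (n + 1), ‖G j (((L : ℤ) ^ (k' + 1 - j)) • y + boxVec (n + 1) ρ) μ'‖ ^ 2)
        + 3 * ((L : ℝ) ^ 2)⁻¹ * ((L : ℝ) ^ d)⁻¹ * ∑ s' : Fin d → Fin L,
            ‖G (j + 1) (((L : ℤ) ^ (k' - j)) • y + boxVec L s') μ
              - ∑ r : Fin d → Fin L, ∑ t ∈ Finset.range L, (((L : ℝ) ^ d)⁻¹) •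
                  conjR (hol (V j) ((L : ℤ) • (((L : ℤ) ^ (k' - j)) • y + boxVec L s')) (treeWord (boxVec L r) ++ seg μ (t : ℤ)))
                    (G j ((L : ℤ) • (((L : ℤ) ^ (k' - j)) • y + boxVec L s') + boxVec L r + (t : ℤ) • e μ) μ)‖ ^ 2 := by
    intro y j hj μ
    have h := normSq_invL_meanT_step_sub_meanT_le L hL1 n hn (V j) (hV j) (ha j) (hplaq j hj.le) (V (j + 1)) (hV (j + 1)) (hδ j) (hbs j hj)
      (G j) (G (j + 1))
      (fun y' μ' => G (j + 1) y' μ' - ∑ r : Fin d → Fin L, ∑ t ∈ Finset.range L, (((L : ℝ) ^ d)⁻¹) •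
          conjR (hol (V j) ((L : ℤ) • y') (treeWord (boxVec L r) ++ seg μ' (t : ℤ))) (G j ((L : ℤ) • y' + boxVec L r + (t : ℤ) • e μ') μ'))
      μ (((L : ℤ) ^ (k' - j)) • y) (fun s' => by simp only [add_sub_cancel])
    rw [hcorner j hj y] at h
    exact h
  exact normSq_covGrad_gauge_le L hL k' V hV a ha hplaq z κ hw hw8 hbU G Λ hΛ0 hΛs _ _
    (fun j hj μ => hrow z j hj μ) (fun j hj μ => hrow (z + e κ) j hj μ)

end Summit.QuantumFields.YangMills.Theorems.Prop7CornerCombChainPerCornerOfStepMean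

end
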